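import Mathlib
import Summits.NavierStokesRegularity.NavierStokesRegularity.Theorems.EulerZoomLiouvillePowerGaugeEulerLiouvilleSelfSimilarPastProfileDissipation
import Summits.NavierStokesRegularity.NavierStokesRegularity.Theorems.EulerZoomLiouvillePowerGaugeEulerLiouvilleSelfSimilarPastProfilePressure
import Summits.NavierStokesRegularity.NavierStokesRegularity.Theorems.EulerZoomLiouvillePowerGaugeEulerLiouvilleSelfSimilarPastExtension
import Summits.NavierStokesRegularity.NavierStokesRegularity.Theorems.EulerZoomLiouvillePowerGaugeEulerLiouvilleSelfSimilarEnergyEquality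
import Summits.NavierStokesRegularity.NavierStokesRegularity.Theorems.EulerZoomLiouvillePowerGaugeEulerLiouvilleSelfSimilarEndpointProfilePoisson
import HarnessLib

/-!
# PAST-EXACT self-similar members of crux E: the PROFILE EQUATIONS and the profile data bundle at large scales
# (crux `EulerZoomLiouville.PowerGaugeEulerLiouville` = stmt-NavierStokesRegularity-19832, line `birth`, rung C1 — transport brick 4)

Route `EulerZoomLiouville` (NavierStokesRegularity); width seat ns-ezl-w1 (assignment of the interim LEAD ns-typeII-p2 g9,
2026-08-28T03:17:55Z; RESIDUE-MEMO-19832-g9 §2).  A member `(u, p, H, c)` of Seregin's power-gauged ancient Euler class that is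
exactly self-similar about `(T, x₀)` with exponent `γ = 1/(2+ρ)` and profile `(V, P)` ON A PAST SUB-SLAB `τ < T₁` only
(`T₁ ≤ 0`, `T₁ ≤ T`) is NOT translated to a class member; what the profile theorems of the lineage consume is

* the origin-centred EXTENSION `(selfSimilarCollapse γ 0 V, selfSimilarCollapsePressure γ 0 P)`, a distributional Euler pair
  on the whole slab (tree `Shifted.isDistributional_selfSimilarCollapse_of_past`), which yields the weak PROFILE EQUATION,
  weak divergence-freeness (`ProfileEquation.*`) and — this file, `Past.profile_pressure_poisson_of_distributional`, the
  tree's `profile_pressure_poisson` with its `IsSuitableWeakSolutionOn` hypothesis weakened to the distributional system it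
  actually uses — the weak PRESSURE POISSON EQUATION `∫ P Δθ = −∫ D²θ(V, V)`;
* the LARGE-SCALE gauge dictionary: `∫_{B_L}|V|² ≤ C L^{1−2ρ}` (`Shifted.profile_energy_growth_of_gaugeA_past`),
  `∫_{B_L}|G|²_F ≤ C L^{1−ρ}` (brick 2), `∫_{B_L}|P|^{3/2} ≤ C L^{2−2ρ}` (brick 3) for `L ≥ 2 − T₁`, with the profile gradient
  `G` of brick 1 — whence `V ∈ L²(B_r) ∩ L⁶(B_r)`, `G ∈ L²(B_r)`, `P ∈ L^{3/2}(B_r)` for EVERY `r` (local Sobolev embedding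
  `exists_eLpNorm_six_le_ball`), and then the PROFILE LOCAL ENERGY EQUALITY for every test function
  (`ProfileEnergy.profile_local_energy_equality`, the lead's Euler-identity lever).

Main theorem `Past.profileData_of_past` (`0 < ρ ≤ ½`): the whole profile-side data bundle of a past-exact member — the
past/shifted twin of `EnergySaturation.profileData_of_selfSimilar` with the three global weights replaced by thresholded
ball growth.  WHAT THIS IS NOT: not NS, not E, not a stub of the skeleton — the input of the (not yet re-plumbed)
sub-extremal / Bronzi–Shvydkoy chain for shifted and past-exact members; `--supports` stmt-19832. [folklore]
-/

noncomputable section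

-- flat `Theorems/<Route><Decl>…` files of one crux share the namespace of the crux (tree convention: `Summit.<S>.<S>.…`)
set_option linter.dupNamespace false

open MeasureTheory Set Filter Topology Metric Function TopologicalSpace
open scoped ENNReal NNReal InnerProductSpace RealInnerProductSpace Laplacian

namespace Summit.NavierStokesRegularity.NavierStokesRegularity.Theorems.PowerGaugeEulerLiouville

open Literature.Analysis Literature.Analysis.FunctionSpaces Literature.Analysis.FluidPDE

namespace Past

/-! ### The weak pressure Poisson equation of the profile from the DISTRIBUTIONAL system only -/

/-- **The weak pressure Poisson equation of the profile, distributional form.**  Let `(u, p)` be a DISTRIBUTIONAL (Euler or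
Navier–Stokes, viscosity `ν`) pair on the slab `(−∞,0) × ℝ³`, `u` a.e.-strongly measurable there, exactly self-similar about
the origin: `u(τ) = selfSimilarCollapse γ 0 V τ`, `p(τ) = selfSimilarCollapsePressure γ 0 P τ` (`τ < 0`), with `‖V‖² ∈ L¹_loc`
and `P ∈ L¹_loc`.  Then `∫ P Δθ = −∫ D²θ(V, V)` for every `θ ∈ C_c^∞(ℝ³)` (one good slice of the distributional pressure
identity, Seregin 2014 §6.3, undone by the dilation `y = (−τ₀)^{−γ} x`).  This is the tree's `profile_pressure_poisson` with
`IsSuitableWeakSolutionOn` weakened to `IsDistributionalNSSolutionOn` (its proof uses nothing else) — the form needed for the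
origin-centred extension of a past-exact member, which is distributional but not known to be suitable.
[cite: Seregin2014, §6.3 (proof of Prop. 3.10)] -/
theorem profile_pressure_poisson_of_distributional {γ ν : ℝ}
    {u : ℝ → EuclideanSpace ℝ (Fin 3) → EuclideanSpace ℝ (Fin 3)} {p : ℝ → EuclideanSpace ℝ (Fin 3) → ℝ}
    {V : EuclideanSpace ℝ (Fin 3) → EuclideanSpace ℝ (Fin 3)} {P : EuclideanSpace ℝ (Fin 3) → ℝ}
    (hsol : IsDistributionalNSSolutionOn (slab (EuclideanSpace ℝ (Fin 3)) (Iio 0) isOpen_Iio) ν 0 u p)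
    (hum : AEStronglyMeasurable (uncurry u)
      (volume.restrict (Iio (0 : ℝ) ×ˢ (univ : Set (EuclideanSpace ℝ (Fin 3))))))
    (hu : ∀ τ : ℝ, τ < 0 → u τ = selfSimilarCollapse γ 0 V τ)
    (hp : ∀ τ : ℝ, τ < 0 → p τ = selfSimilarCollapsePressure γ 0 P τ)
    (hV2 : LocallyIntegrable (fun y => ‖V y‖ ^ 2) volume) (hP1 : LocallyIntegrable P volume)
    {θ : EuclideanSpace ℝ (Fin 3) → ℝ} (hθ : ContDiff ℝ (⊤ : ℕ∞) θ) (hθc : HasCompactSupport θ) :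
    ∫ y, P y * (Δ θ) y = -∫ y, fderiv ℝ (fderiv ℝ θ) y (V y) (V y) := by
  -- adapted from the tree's `profile_pressure_poisson` (…SelfSimilarEndpointProfilePoisson), `hsw.distributional ↦ hsol`
  have hVm : AEStronglyMeasurable V volume := aestronglyMeasurable_profile hum hu
  -- restrict the distributional solution to the product region `(−2,−1) × ℝ³`
  set Q : Opens (ℝ × EuclideanSpace ℝ (Fin 3)) :=
    ⟨Ioo (-2 : ℝ) (-1) ×ˢ ((⊤ : Opens (EuclideanSpace ℝ (Fin 3))) : Set (EuclideanSpace ℝ (Fin 3))),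
      isOpen_Ioo.prod (⊤ : Opens (EuclideanSpace ℝ (Fin 3))).isOpen⟩ with hQ
  have hQle : Q ≤ slab (EuclideanSpace ℝ (Fin 3)) (Iio 0) isOpen_Iio := by
    intro z hz
    have hz' : z ∈ Ioo (-2 : ℝ) (-1) ×ˢ ((⊤ : Opens (EuclideanSpace ℝ (Fin 3))) :
        Set (EuclideanSpace ℝ (Fin 3))) := hz
    have h12 := (mem_prod.1 hz').1.2
    exact mem_slab.2 (show z.1 < 0 by linarith)
  have hns : IsDistributionalNSSolutionOn Q ν 0 u p := hsol.of_le hQle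
  have hslice := IsDistributionalNSSolutionOn.ae_forall_slice_pressure_identity
    (a := -2) (b := -1) (Ω := (⊤ : Opens (EuclideanSpace ℝ (Fin 3)))) hns
    (by
      have e : (uncurry (0 : ℝ → EuclideanSpace ℝ (Fin 3) → EuclideanSpace ℝ (Fin 3))) =
          fun _ => 0 := by funext z; rfl
      rw [e]; exact locallyIntegrableOn_zero) (fun φ _ => by simp)
  -- a good time
  have hne : (ae ((volume : Measure ℝ).restrict (Ioo (-2 : ℝ) (-1)))).NeBot := by
    rw [ae_neBot, Ne, Measure.restrict_eq_zero, Real.volume_Ioo]; norm_num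
  obtain ⟨τ₀, hτ₀, hτ₀I⟩ := (hslice.and (ae_restrict_mem measurableSet_Ioo)).exists
  have hτ₀0 : τ₀ < 0 := by have := hτ₀I.2; linarith
  have hs : 0 < -τ₀ := neg_pos.2 hτ₀0
  set c : ℝ := (-τ₀) ^ (γ - 1) with hc
  set d : ℝ := (-τ₀) ^ (-γ) with hd
  have hc0 : 0 < c := Real.rpow_pos_of_pos hs _
  have hd0 : 0 < d := Real.rpow_pos_of_pos hs _
  have huτ : u τ₀ = fun x => c • V (d • x) := by
    rw [hu τ₀ hτ₀0]; funext x; rw [selfSimilarCollapse_apply, zero_sub]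
  have hpτ : p τ₀ = fun x => (-τ₀) ^ (2 * (γ - 1)) * P (d • x) := by
    rw [hp τ₀ hτ₀0]; funext x; rw [selfSimilarCollapsePressure_apply, zero_sub]
  have hc2 : (-τ₀) ^ (2 * (γ - 1)) = c ^ 2 := by
    rw [hc, ← Real.rpow_natCast ((-τ₀) ^ (γ - 1)) 2, ← Real.rpow_mul hs.le]
    congr 1; push_cast; ring
  -- the slice side conditions at `τ₀`
  have h1 : AEStronglyMeasurable (u τ₀)
      (volume.restrict ((⊤ : Opens (EuclideanSpace ℝ (Fin 3))) : Set (EuclideanSpace ℝ (Fin 3)))) := by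
    rw [Opens.coe_top, Measure.restrict_univ, huτ]
    exact (hVm.comp_quasiMeasurePreserving (quasiMeasurePreserving_smul hd0.ne')).const_smul c
  have h2 : LocallyIntegrableOn (fun x => ‖u τ₀ x‖ ^ 2)
      ((⊤ : Opens (EuclideanSpace ℝ (Fin 3))) : Set (EuclideanSpace ℝ (Fin 3))) volume := by
    rw [Opens.coe_top, locallyIntegrableOn_univ, huτ]
    have h := (locallyIntegrable_comp_smul hV2 hd0.ne').smul (c ^ 2)
    refine h.congr (Eventually.of_forall fun x => ?_)
    simp only [Pi.smul_apply, smul_eq_mul, norm_smul, Real.norm_eq_abs, abs_of_pos hc0]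
    ring
  have h3 : LocallyIntegrableOn (p τ₀)
      ((⊤ : Opens (EuclideanSpace ℝ (Fin 3))) : Set (EuclideanSpace ℝ (Fin 3))) volume := by
    rw [Opens.coe_top, locallyIntegrableOn_univ, hpτ]
    have h := (locallyIntegrable_comp_smul hP1 hd0.ne').smul ((-τ₀) ^ (2 * (γ - 1)))
    refine h.congr (Eventually.of_forall fun x => ?_)
    simp only [Pi.smul_apply, smul_eq_mul]
  have key := hτ₀ h1 h2 h3
  -- the dilated test function `ψ = θ(d ·)`
  set ψ : EuclideanSpace ℝ (Fin 3) → ℝ := fun x => θ (d • x) with hψ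
  have hψT : IsTestFunctionOn (⊤ : Opens (EuclideanSpace ℝ (Fin 3))) ψ :=
    ⟨hθ.comp (contDiff_const_smul d), hθc.comp_smul hd0.ne', by simp⟩
  have hid := key ψ hψT
  -- Laplacian and Hessian of the dilated test function
  have hΔψ : ∀ x, Δ ψ x = d ^ 2 * (Δ θ) (d • x) := fun x => by
    rw [hψ, laplacian_comp_smul_eq θ d x, smul_eq_mul]
  have hHψ : ∀ x (v : EuclideanSpace ℝ (Fin 3)),
      fderiv ℝ (fderiv ℝ ψ) x v v = d ^ 2 * fderiv ℝ (fderiv ℝ θ) (d • x) v v := fun x v => by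
    rw [hψ, fderiv_fderiv_comp_smul θ d]
    rfl
  -- rewrite both sides of the slice identity as dilated profile integrals
  have hvol : |((d ^ Module.finrank ℝ (EuclideanSpace ℝ (Fin 3)))⁻¹)| = (d ^ 3)⁻¹ := by
    rw [finrank_euclideanSpace_fin, abs_of_pos (by positivity)]
  have hcs1 : ∫ x, P (d • x) * (Δ θ) (d • x) = (d ^ 3)⁻¹ * ∫ y, P y * (Δ θ) y := by
    have h := Measure.integral_comp_smul volume (fun y => P y * (Δ θ) y) d
    simp only [hvol, smul_eq_mul] at h
    exact h
  have hcs2 : ∫ x, fderiv ℝ (fderiv ℝ θ) (d • x) (V (d • x)) (V (d • x)) =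
      (d ^ 3)⁻¹ * ∫ y, fderiv ℝ (fderiv ℝ θ) y (V y) (V y) := by
    have h := Measure.integral_comp_smul volume (fun y => fderiv ℝ (fderiv ℝ θ) y (V y) (V y)) d
    simp only [hvol, smul_eq_mul] at h
    exact h
  have hL : ∫ x, p τ₀ x * Δ ψ x = c ^ 2 * d ^ 2 * ((d ^ 3)⁻¹ * ∫ y, P y * (Δ θ) y) := by
    have e : (fun x => p τ₀ x * Δ ψ x) = fun x => (c ^ 2 * d ^ 2) * (P (d • x) * (Δ θ) (d • x)) := by
      funext x; rw [hpτ, hΔψ, hc2]; ring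
    rw [e, integral_const_mul, hcs1]
  have hR : ∫ x, fderiv ℝ (fderiv ℝ ψ) x (u τ₀ x) (u τ₀ x) =
      c ^ 2 * d ^ 2 * ((d ^ 3)⁻¹ * ∫ y, fderiv ℝ (fderiv ℝ θ) y (V y) (V y)) := by
    have e : (fun x => fderiv ℝ (fderiv ℝ ψ) x (u τ₀ x) (u τ₀ x)) =
        fun x => (c ^ 2 * d ^ 2) * (fderiv ℝ (fderiv ℝ θ) (d • x) (V (d • x)) (V (d • x))) := by
      funext x
      rw [huτ, hHψ, bilin_apply_smul_self]
      ring
    rw [e, integral_const_mul, hcs2]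
  rw [hL, hR] at hid
  have hcd : c ^ 2 * d ^ 2 * (d ^ 3)⁻¹ ≠ 0 := by positivity
  have hid' : c ^ 2 * d ^ 2 * (d ^ 3)⁻¹ * ∫ y, P y * (Δ θ) y =
      c ^ 2 * d ^ 2 * (d ^ 3)⁻¹ * (-∫ y, fderiv ℝ (fderiv ℝ θ) y (V y) (V y)) := by
    linarith
  exact mul_left_cancel₀ hcd hid'

/-! ### Integrability of a profile on ALL balls from thresholded growth -/

/-- A thresholded growth bound `∫_{B_L} f ≤ C L^θ` for `L ≥ L₀` (`C < ∞`) makes `∫_{B_r} f` finite for EVERY radius `r`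
(`B_r ⊆ B_{max(r, L₀)}`). [folklore] -/
theorem lintegral_ball_lt_top_of_growth {f : EuclideanSpace ℝ (Fin 3) → ℝ≥0∞} {C : ℝ≥0∞} (hC : C ≠ ⊤)
    {L₀ θ : ℝ} (h : ∀ L : ℝ, L₀ ≤ L → ∫⁻ y in ball (0 : EuclideanSpace ℝ (Fin 3)) L, f y ≤ C * ENNReal.ofReal (L ^ θ))
    (r : ℝ) : ∫⁻ y in ball (0 : EuclideanSpace ℝ (Fin 3)) r, f y < ⊤ :=
  calc ∫⁻ y in ball (0 : EuclideanSpace ℝ (Fin 3)) r, f y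
      ≤ ∫⁻ y in ball (0 : EuclideanSpace ℝ (Fin 3)) (max r L₀), f y :=
        lintegral_mono_set (ball_subset_ball (le_max_left _ _))
    _ ≤ C * ENNReal.ofReal ((max r L₀) ^ θ) := h _ (le_max_right _ _)
    _ < ⊤ := ENNReal.mul_lt_top hC.lt_top ENNReal.ofReal_lt_top

/-- `V ∈ L²(B_r)` for every `r` from finiteness of `∫_{B_r}‖V‖²`. [folklore] -/
theorem memLp_two_ball_of_lintegral_lt_top {V : EuclideanSpace ℝ (Fin 3) → EuclideanSpace ℝ (Fin 3)}
    (hVm : AEStronglyMeasurable V volume)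
    (h : ∀ r : ℝ, ∫⁻ y in ball (0 : EuclideanSpace ℝ (Fin 3)) r, ‖V y‖ₑ ^ 2 < ⊤) (r : ℝ) :
    MemLp V 2 (volume.restrict (ball (0 : EuclideanSpace ℝ (Fin 3)) r)) := by
  refine ⟨hVm.restrict, ?_⟩
  rw [eLpNorm_lt_top_iff_lintegral_rpow_enorm_lt_top two_ne_zero ENNReal.ofNat_ne_top]
  have e : ∀ y, ‖V y‖ₑ ^ (2 : ℝ≥0∞).toReal = ‖V y‖ₑ ^ 2 := fun y => by
    rw [ENNReal.toReal_ofNat, ENNReal.rpow_ofNat]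
  simp_rw [e]
  exact h r

/-- `G ∈ L²(B_r)` for every `r` from finiteness of `∫_{B_r}|G|²_F` (`‖L‖² ≤ |L|²_F`). [folklore] -/
theorem memLp_two_ball_gradient_of_lintegral_lt_top
    {G : EuclideanSpace ℝ (Fin 3) → EuclideanSpace ℝ (Fin 3) →L[ℝ] EuclideanSpace ℝ (Fin 3)}
    (hGm : AEStronglyMeasurable G volume)
    (h : ∀ r : ℝ, ∫⁻ y in ball (0 : EuclideanSpace ℝ (Fin 3)) r, ENNReal.ofReal (frobeniusNormSq (G y)) < ⊤) (r : ℝ) :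
    MemLp G 2 (volume.restrict (ball (0 : EuclideanSpace ℝ (Fin 3)) r)) :=
  ⟨hGm.restrict, lt_of_le_of_lt (eLpNorm_two_le_lintegral_frobeniusNormSq_rpow _ G)
    (ENNReal.rpow_lt_top_of_nonneg (by norm_num) (h r).ne)⟩

/-- `P ∈ L^{3/2}(B_r)` for every `r` from finiteness of `∫_{B_r}|P|^{3/2}`. [folklore] -/
theorem memLp_threeHalves_ball_of_lintegral_lt_top {P : EuclideanSpace ℝ (Fin 3) → ℝ}
    (hPm : AEStronglyMeasurable P volume)
    (h : ∀ r : ℝ, ∫⁻ y in ball (0 : EuclideanSpace ℝ (Fin 3)) r, ‖P y‖ₑ ^ (3 / 2 : ℝ) < ⊤) (r : ℝ) :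
    MemLp P (3 / 2 : ℝ≥0∞) (volume.restrict (ball (0 : EuclideanSpace ℝ (Fin 3)) r)) := by
  refine ⟨hPm.restrict, ?_⟩
  rw [eLpNorm_eq_lintegral_rpow_enorm_toReal (by
      exact (ENNReal.div_pos (by norm_num) (by norm_num)).ne') (ENNReal.div_ne_top (by norm_num) (by norm_num))]
  have hr : ((3 / 2 : ℝ≥0∞)).toReal = 3 / 2 := by
    rw [ENNReal.toReal_div, ENNReal.toReal_ofNat, ENNReal.toReal_ofNat]
  rw [hr]
  exact ENNReal.rpow_lt_top_of_nonneg (by norm_num) (h r).ne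

/-- `V ∈ L⁶(B_r)` for every `r` (local Sobolev embedding `H¹(B) ⊂ L⁶(B)`, tree `exists_eLpNorm_six_le_ball`) from
`V ∈ L²(B_r)`, a whole-space weak gradient `G` and finiteness of `∫_{B_r}|G|²_F`. [folklore] -/
theorem memLp_six_ball_of_gradient {V : EuclideanSpace ℝ (Fin 3) → EuclideanSpace ℝ (Fin 3)}
    {G : EuclideanSpace ℝ (Fin 3) → EuclideanSpace ℝ (Fin 3) →L[ℝ] EuclideanSpace ℝ (Fin 3)}
    (hVm : AEStronglyMeasurable V volume)
    (hVG : HasWeakFDerivOn (⊤ : Opens (EuclideanSpace ℝ (Fin 3))) volume V G)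
    (hV2 : ∀ r : ℝ, MemLp V 2 (volume.restrict (ball (0 : EuclideanSpace ℝ (Fin 3)) r)))
    (hG : ∀ r : ℝ, ∫⁻ y in ball (0 : EuclideanSpace ℝ (Fin 3)) r, ENNReal.ofReal (frobeniusNormSq (G y)) < ⊤)
    (r : ℝ) : MemLp V 6 (volume.restrict (ball (0 : EuclideanSpace ℝ (Fin 3)) r)) := by
  obtain ⟨C, hC⟩ := exists_eLpNorm_six_le_ball (E := EuclideanSpace ℝ (Fin 3)) finrank_euclideanSpace_fin
    (0 : EuclideanSpace ℝ (Fin 3)) r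
  have hVGball : HasWeakFDerivOn (⟨ball (0 : EuclideanSpace ℝ (Fin 3)) r, isOpen_ball⟩ :
      Opens (EuclideanSpace ℝ (Fin 3))) volume V G := HasWeakFDerivOn.mono_set_holds hVG le_top
  have h := hC V G hVGball (hV2 r).eLpNorm_ne_top
  refine ⟨hVm.restrict, lt_of_le_of_lt h ?_⟩
  refine ENNReal.mul_lt_top ENNReal.coe_lt_top (ENNReal.add_lt_top.2 ⟨(hV2 r).eLpNorm_lt_top, ?_⟩)
  exact ENNReal.rpow_lt_top_of_nonneg (by norm_num) (hG r).ne

/-! ### The profile data bundle of a past-exact member -/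

/-- **THE PROFILE DATA OF A PAST-EXACT SELF-SIMILAR MEMBER** (`0 < ρ ≤ ½`, `γ = 1/(2+ρ)`).  Let `(u, p)` be a distributional
Euler pair on the slab `(−∞,0) × ℝ³` with weak spatial gradient `H` and the three power gauges at the origin
(`a^{2ρ}A(a) ≤ c`, `a^{ρ}E(a) ≤ c`, `a^{2ρ}D(a) ≤ c`, all `a > 0`), exactly self-similar about `(T, x₀)` with profile `(V, P)`
FOR `τ < T₁` ONLY (`T₁ ≤ 0`, `T₁ ≤ T`).  Then there is a profile gradient `G` such that: `V`, `P`, `G` are a.e.-strongly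
measurable; `G` is a weak derivative of `V` on `ℝ³`; `H(τ) = (T−τ)^{−1} • G((T−τ)^{−γ}(· − x₀))` a.e. for a.e. `τ < T₁`;
the LARGE-SCALE growth bounds `∫_{B_L}|V|² ≤ C L^{1−2ρ}`, `∫_{B_L}|G|²_F ≤ C L^{1−ρ}`, `∫_{B_L}|P|^{3/2} ≤ C L^{2−2ρ}` hold for
`L ≥ 2 − T₁`; `V ∈ L⁶(B_r)`, `G ∈ L²(B_r)`, `P ∈ L^{3/2}(B_r)` for every `r`; `V` is weakly divergence free; the weak profile
equation, the weak pressure Poisson equation `∫ P Δθ = −∫ D²θ(V,V)` and the PROFILE LOCAL ENERGY EQUALITY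
`(2 − 5γ)∫σ|V|² = ∫(|V|²+2P)⟪V,∇σ⟫ + γ∫|V|²⟪y,∇σ⟫` hold for every test function.  (Past/shifted twin of
`EnergySaturation.profileData_of_selfSimilar`: bricks 1–3, the far-past `A`-gauge, the origin-centred extension, and the
lineage's `ProfileEquation.*` / `ProfileEnergy.profile_local_energy_equality`.) [folklore] -/
theorem profileData_of_past {ρ : ℝ} (hρ : 0 < ρ) (hρh : ρ ≤ 1 / 2)
    {T T₁ : ℝ} (hT₁ : T₁ ≤ 0) (hTT₁ : T₁ ≤ T) (x₀ : EuclideanSpace ℝ (Fin 3))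
    {u : ℝ → EuclideanSpace ℝ (Fin 3) → EuclideanSpace ℝ (Fin 3)} {p : ℝ → EuclideanSpace ℝ (Fin 3) → ℝ}
    {H : ℝ → EuclideanSpace ℝ (Fin 3) → EuclideanSpace ℝ (Fin 3) →L[ℝ] EuclideanSpace ℝ (Fin 3)} {c : ℝ≥0}
    (hsol : IsDistributionalNSSolutionOn (slab (EuclideanSpace ℝ (Fin 3)) (Iio 0) isOpen_Iio) 0 0 u p)
    (hH : HasWeakSpatialGradientOn (slab (EuclideanSpace ℝ (Fin 3)) (Iio 0) isOpen_Iio) u H)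
    (hA : ∀ a : ℝ, 0 < a →
      ENNReal.ofReal (a ^ (2 * ρ)) * cknA a (0 : ℝ × EuclideanSpace ℝ (Fin 3)) u ≤ (c : ℝ≥0∞))
    (hE : ∀ a : ℝ, 0 < a →
      ENNReal.ofReal (a ^ ρ) * cknE a (0 : ℝ × EuclideanSpace ℝ (Fin 3)) H ≤ (c : ℝ≥0∞))
    (hD : ∀ a : ℝ, 0 < a →
      ENNReal.ofReal (a ^ (2 * ρ)) * cknD a (0 : ℝ × EuclideanSpace ℝ (Fin 3)) p ≤ (c : ℝ≥0∞))
    {V : EuclideanSpace ℝ (Fin 3) → EuclideanSpace ℝ (Fin 3)} {P : EuclideanSpace ℝ (Fin 3) → ℝ}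
    (hu : ∀ τ : ℝ, τ < T₁ → u τ = fun x => selfSimilarCollapse (1 / (2 + ρ)) T V τ (x - x₀))
    (hp : ∀ τ : ℝ, τ < T₁ → p τ = fun x => selfSimilarCollapsePressure (1 / (2 + ρ)) T P τ (x - x₀)) :
    ∃ G : EuclideanSpace ℝ (Fin 3) → EuclideanSpace ℝ (Fin 3) →L[ℝ] EuclideanSpace ℝ (Fin 3),
      AEStronglyMeasurable V volume ∧ AEStronglyMeasurable P volume ∧ AEStronglyMeasurable G volume ∧
      HasWeakFDerivOn (⊤ : Opens (EuclideanSpace ℝ (Fin 3))) volume V G ∧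
      (∀ᵐ τ ∂((volume : Measure ℝ).restrict (Iio T₁)),
        H τ =ᵐ[volume] fun x => (T - τ) ^ (-1 : ℝ) • G ((T - τ) ^ (-(1 / (2 + ρ))) • (x - x₀))) ∧
      (∃ C : ℝ≥0∞, C ≠ ⊤ ∧ ∀ L : ℝ, 2 - T₁ ≤ L →
        ∫⁻ y in ball (0 : EuclideanSpace ℝ (Fin 3)) L, ‖V y‖ₑ ^ 2 ≤ C * ENNReal.ofReal (L ^ (1 - 2 * ρ))) ∧
      (∃ C : ℝ≥0∞, C ≠ ⊤ ∧ ∀ L : ℝ, 2 - T₁ ≤ L →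
        ∫⁻ y in ball (0 : EuclideanSpace ℝ (Fin 3)) L, ENNReal.ofReal (frobeniusNormSq (G y)) ≤
          C * ENNReal.ofReal (L ^ (1 - ρ))) ∧
      (∃ C : ℝ≥0∞, C ≠ ⊤ ∧ ∀ L : ℝ, 2 - T₁ ≤ L →
        ∫⁻ y in ball (0 : EuclideanSpace ℝ (Fin 3)) L, ‖P y‖ₑ ^ (3 / 2 : ℝ) ≤
          C * ENNReal.ofReal (L ^ (2 - 2 * ρ))) ∧
      (∀ r : ℝ, MemLp V 6 (volume.restrict (ball (0 : EuclideanSpace ℝ (Fin 3)) r))) ∧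
      (∀ r : ℝ, MemLp G 2 (volume.restrict (ball (0 : EuclideanSpace ℝ (Fin 3)) r))) ∧
      (∀ r : ℝ, MemLp P (3 / 2 : ℝ≥0∞) (volume.restrict (ball (0 : EuclideanSpace ℝ (Fin 3)) r))) ∧
      IsWeaklyDivFree V ∧
      (∀ ψ : EuclideanSpace ℝ (Fin 3) → EuclideanSpace ℝ (Fin 3),
        IsTestFunctionOn (⊤ : Opens (EuclideanSpace ℝ (Fin 3))) ψ →
          ∫ x, (⟪V x, fderiv ℝ ψ x (V x)⟫ + P x * VectorCalculus.divergence ψ x +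
            (1 / (2 + ρ)) * ⟪V x, fderiv ℝ ψ x x⟫ + (4 * (1 / (2 + ρ)) - 1) * ⟪V x, ψ x⟫) = 0) ∧
      (∀ θ : EuclideanSpace ℝ (Fin 3) → ℝ, ContDiff ℝ (⊤ : ℕ∞) θ → HasCompactSupport θ →
        ∫ y, P y * (Δ θ) y = -∫ y, fderiv ℝ (fderiv ℝ θ) y (V y) (V y)) ∧
      (∀ σ : EuclideanSpace ℝ (Fin 3) → ℝ, IsTestFunctionOn (⊤ : Opens (EuclideanSpace ℝ (Fin 3))) σ →
        (2 - 5 * (1 / (2 + ρ))) * ∫ x, σ x * ‖V x‖ ^ 2 =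
          (∫ x, (‖V x‖ ^ 2 + 2 * P x) * ⟪V x, gradient σ x⟫) +
            (1 / (2 + ρ)) * ∫ x, ‖V x‖ ^ 2 * ⟪x, gradient σ x⟫) := by
  have hρ1 : ρ < 1 := by linarith
  -- ### the origin-centred extension: a distributional Euler pair on the whole slab
  have hext := Shifted.isDistributional_selfSimilarCollapse_of_past hT₁ hTT₁ x₀ hsol hu hp
  -- ### measurability
  have hum' : AEStronglyMeasurable (uncurry (selfSimilarCollapse (1 / (2 + ρ)) 0 V))
      (volume.restrict (Iio (0 : ℝ) ×ˢ (univ : Set (EuclideanSpace ℝ (Fin 3))))) := by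
    have := hext.1.aestronglyMeasurable
    simpa [slab] using this
  have hpm' : AEStronglyMeasurable (uncurry (selfSimilarCollapsePressure (1 / (2 + ρ)) 0 P))
      (volume.restrict (Iio (0 : ℝ) ×ˢ (univ : Set (EuclideanSpace ℝ (Fin 3))))) := by
    have := hext.2.2.1.aestronglyMeasurable
    simpa [slab] using this
  have hVm : AEStronglyMeasurable V volume :=
    aestronglyMeasurable_profile (u := selfSimilarCollapse (1 / (2 + ρ)) 0 V) (V := V) hum' fun _ _ => rfl
  have hPm : AEStronglyMeasurable P volume :=
    aestronglyMeasurable_pressureProfile (p := selfSimilarCollapsePressure (1 / (2 + ρ)) 0 P) (P := P) hpm'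
      fun _ _ => rfl
  have hpm : AEStronglyMeasurable (uncurry p)
      (volume.restrict (Iio (0 : ℝ) ×ˢ (univ : Set (EuclideanSpace ℝ (Fin 3))))) := by
    have := hsol.2.2.1.aestronglyMeasurable
    simpa [slab] using this
  have hHm : AEStronglyMeasurable (uncurry H)
      (volume.restrict (Iio (0 : ℝ) ×ˢ (univ : Set (EuclideanSpace ℝ (Fin 3))))) := by
    have := hH.locallyIntegrableOn_grad.aestronglyMeasurable
    simpa [slab] using this
  -- ### the profile gradient (brick 1) and the large-scale gauge dictionary (bricks 2, 3, far-past `A`)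
  obtain ⟨G, hGm, hVG, hHae⟩ := exists_profileGradient_ae_of_past hH hT₁ hTT₁ x₀ hu
  have hgrowthA := Shifted.profile_energy_growth_of_gaugeA_past hρ hρh hT₁ hTT₁ x₀ hu hA
  have hgrowthE := profile_gradient_growth_of_gaugeE_past hρ hρ1 hT₁ hTT₁ x₀ hHm hHae hE
  have hgrowthD := profile_pressure_growth_of_gaugeD_past hρ hρ1 hT₁ hTT₁ x₀ hpm hp hD
  obtain ⟨CA, hCA, hA'⟩ := id hgrowthA
  obtain ⟨CE, hCE, hE'⟩ := id hgrowthE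
  obtain ⟨CD, hCD, hD'⟩ := id hgrowthD
  -- ### integrability on all balls
  have hV2fin : ∀ r : ℝ, ∫⁻ y in ball (0 : EuclideanSpace ℝ (Fin 3)) r, ‖V y‖ₑ ^ 2 < ⊤ :=
    lintegral_ball_lt_top_of_growth hCA hA'
  have hGfin : ∀ r : ℝ, ∫⁻ y in ball (0 : EuclideanSpace ℝ (Fin 3)) r, ENNReal.ofReal (frobeniusNormSq (G y)) < ⊤ :=
    lintegral_ball_lt_top_of_growth hCE hE'
  have hPfin : ∀ r : ℝ, ∫⁻ y in ball (0 : EuclideanSpace ℝ (Fin 3)) r, ‖P y‖ₑ ^ (3 / 2 : ℝ) < ⊤ :=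
    lintegral_ball_lt_top_of_growth hCD hD'
  have hV2R : ∀ r : ℝ, MemLp V 2 (volume.restrict (ball (0 : EuclideanSpace ℝ (Fin 3)) r)) :=
    memLp_two_ball_of_lintegral_lt_top hVm hV2fin
  have hG2R : ∀ r : ℝ, MemLp G 2 (volume.restrict (ball (0 : EuclideanSpace ℝ (Fin 3)) r)) :=
    memLp_two_ball_gradient_of_lintegral_lt_top hGm hGfin
  have hP32R : ∀ r : ℝ, MemLp P (3 / 2 : ℝ≥0∞) (volume.restrict (ball (0 : EuclideanSpace ℝ (Fin 3)) r)) :=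
    memLp_threeHalves_ball_of_lintegral_lt_top hPm hPfin
  have hV6R : ∀ r : ℝ, MemLp V 6 (volume.restrict (ball (0 : EuclideanSpace ℝ (Fin 3)) r)) :=
    memLp_six_ball_of_gradient hVm hVG hV2R hGfin
  -- ### local integrability of `V`, `|V|²`, `P`
  have hVloc : LocallyIntegrable V volume := locallyIntegrableOn_univ.1 (by
    simpa only [Opens.coe_top] using hVG.locallyIntegrableOn)
  have hV2loc : LocallyIntegrable (fun y => ‖V y‖ ^ 2) volume := by
    refine (locallyIntegrable_iff).2 fun K hK => ?_
    obtain ⟨r, hr⟩ := hK.isBounded.subset_ball (0 : EuclideanSpace ℝ (Fin 3))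
    have h := (hV2R r).integrable_norm_pow two_ne_zero
    exact IntegrableOn.mono_set (show IntegrableOn (fun y => ‖V y‖ ^ 2) (ball 0 r) volume from h) hr
  have hPloc : LocallyIntegrable P volume := by
    refine (locallyIntegrable_iff).2 fun K hK => ?_
    obtain ⟨r, hr⟩ := hK.isBounded.subset_ball (0 : EuclideanSpace ℝ (Fin 3))
    haveI : IsFiniteMeasure ((volume : Measure (EuclideanSpace ℝ (Fin 3))).restrict
        (ball (0 : EuclideanSpace ℝ (Fin 3)) r)) :=
      isFiniteMeasure_restrict.2 measure_ball_lt_top.ne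
    have h : IntegrableOn P (ball (0 : EuclideanSpace ℝ (Fin 3)) r) volume :=
      memLp_one_iff_integrable.1 ((hP32R r).mono_exponent (by
        rw [ENNReal.le_div_iff_mul_le (Or.inl (by norm_num)) (Or.inl (by norm_num))]; norm_num))
    exact h.mono_set hr
  -- ### the equations, read off the extension
  have heq := fun (ψ : EuclideanSpace ℝ (Fin 3) → EuclideanSpace ℝ (Fin 3))
      (hψ : IsTestFunctionOn (⊤ : Opens (EuclideanSpace ℝ (Fin 3))) ψ) =>
    ProfileEquation.weak_profile_equation hext (fun _ _ => rfl) (fun _ _ => rfl) hVloc hV2loc hPloc hψ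
  have hdiv : IsWeaklyDivFree V := ProfileEquation.profile_isWeaklyDivFree hext (fun _ _ => rfl) hVloc
  have hPoisson : ∀ θ : EuclideanSpace ℝ (Fin 3) → ℝ, ContDiff ℝ (⊤ : ℕ∞) θ → HasCompactSupport θ →
      ∫ y, P y * (Δ θ) y = -∫ y, fderiv ℝ (fderiv ℝ θ) y (V y) (V y) :=
    fun θ hθ hθc => profile_pressure_poisson_of_distributional hext hum' (fun _ _ => rfl) (fun _ _ => rfl)
      hV2loc hPloc hθ hθc
  have hEE := fun (σ : EuclideanSpace ℝ (Fin 3) → ℝ)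
      (hσ : IsTestFunctionOn (⊤ : Opens (EuclideanSpace ℝ (Fin 3))) σ) =>
    ProfileEnergy.profile_local_energy_equality hVG hV6R hG2R hPm hP32R hdiv heq hσ
  exact ⟨G, hVm, hPm, hGm, hVG, hHae, hgrowthA, hgrowthE, hgrowthD, hV6R, hG2R, hP32R, hdiv, heq, hPoisson, hEE⟩

end Past

end Summit.NavierStokesRegularity.NavierStokesRegularity.Theorems.PowerGaugeEulerLiouville
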